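import Literature.Analysis.Matrix.TraceInvMulMixedDifferenceOfFloor
import Literature.Analysis.Matrix.TraceInvMulMixedDifferenceEntrywise
import Literature.Analysis.Matrix.LocalisedDisplacementRows
import HarnessLib

/-!
# `ΔΔ(K⁻¹H)` over a rectangle — THE CAPSTONE OF THE RESPONSE ROAD: trace, entrywise-ℓ¹ and Hilbert–Schmidt bounds END TO END from a responding
# two-parameter background (localised DERIVATIVE rows), two local maps and STIFFNESS at the four corners

Topic `Literature/Analysis/Matrix`; namespace `Literature.Analysis.Matrix`.  Sequel of `TraceInvMulMixedDifferenceLocalMaps.lean` ∕ `…OfFloor.lean`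
(trace, end to end), `TraceInvMulMixedDifferenceEntrywise.lean` (ℓ¹ ∕ Hilbert–Schmidt under summed rows) and `LocalisedDisplacementRows.lean`
(derivative rows ⟹ displacement rows).  Everything here is PROVED; no definitions, no named facts.

* §1 ★`summedRows_of_localMaps` — the NINE summed variation rows of the rectangle theorems (`hK1c0 hK1c1 hK1r0 hK2c1 hK2r0 hK12 hH1r hH2r hH12`,
  letters `k₁ = k₂ = L_K·V²e^{2θr}δ`, `h₁ = h₂ = L_H·V²e^{2θr}δ`, `k₁₂ = (L_K Vμ + L_K₂V²δ²)e^{2θr}V·S_loc`, `h₁₂` likewise) DERIVED from locality (orders 1, 2;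
  radius∕range `r`) of `K, H` and the five displacement rows of `U₀₀ U₁₀ U₀₁ U₁₁` — the derivation inside ✓`abs_fourPt_trace_inv_mul_le_of_localMaps`,
  exported once so that every edition (trace, ℓ¹, HS) docks on it.
* §2 ★★★`trace_l1_hs_fourPt_inv_mul_le_of_response` — THE ONE-LINE STATEMENT: for a two-parameter family of configurations `U(σ,τ)` on `[0,s]×[0,t]`
  with localised partial derivatives (`|∂_σU| ≤ δe^{−θd}`, `|∂_τU| ≤ δe^{−θd′}`, mixed `|∂_σ∂_τU| ≤ μe^{−θ(d+d′)}` — the output currency of the tree's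
  response theorems), two local maps `K, H` (orders 1, 2; radius∕range 1), and at the four corners `U(0,0), U(s,0), U(0,t), U(s,t)` a Hessian `K` with
  off-diagonal sums `≤ h` and gap `m` (`h(e^θ−1) ≤ m∕2`): the second variation of the one-loop operator `X := ΔΔ(K(U)⁻¹H(U))` satisfies
  `|tr X| ≤ C·s·t·e^{−(θ−θ₂)R}`, `Σ_{a,e}|X a e| ≤ S_dist·C·s·t·e^{−(θ−θ₂)R}` and `√(Σ X²) ≤ S_dist·C·s·t·e^{−(θ−θ₂)R}`, `C` the explicit constant of
  ✓`abs_fourPt_trace_inv_mul_le_of_floor` (`α = 2∕m`).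

WHY: cell `ym3-torus`, crux `FluctuationComparisonRegPrIntL`, DISCHARGE-SPEC §11 (xv) as sharpened by LEAD RULING №58 («TRACE and HILBERT–SCHMIDT norm of
the second variation of the one-loop operator, `≤ C(O)e^{−κ·tdist(b,b′)}` uniformly in `L^m`»): this is its layer (1) on the response road by ONE name —
[Balaban1985Variational] (9)–(10) (stiffness, localised response) + [Balaban1984PropagatorsII] (1.33) (propagator decay) in finite-dimensional dress.
HONEST SCOPE: finite-dimensional linear algebra and calculus; layer (2) — the m-uniformity of `m, h, θ, V, S_loc, S_dist, δ, μ, η` in the consumer's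
indexing — is NOT addressed; nothing here bears on the Yang–Mills mass gap (Clay), which is NOT proved.

References: T. Bałaban, CMP 102 (1985) 277, Thm 1 (9)–(10) p. 279 [Balaban1985Variational]; CMP 96 (1984) 223, (1.33) [Balaban1984PropagatorsII];
J.-M. Combes, L. Thomas, CMP 34 (1973) 251 [CombesThomas1973]; J. Glimm, A. Jaffe, *Quantum Physics* (1987) §18.2 [GlimmJaffe1987].
-/

noncomputable section

open Matrix Finset Set
open scoped Matrix

namespace Literature.Analysis.Matrix

variable {n : Type*} [Fintype n] [DecidableEq n]

/-! ## §1 The nine summed rows from locality and displacement -/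

omit [DecidableEq n] in
/-- ★ **THE SUMMED VARIATION ROWS FROM LOCALITY AND DISPLACEMENT.**  Two maps `K, H : (n → ℝ) → Matrix n n ℝ` local of radius `r` in the row
index with first∕second-order constants `L_K, L_K₂`, `L_H, L_H₂` and values of range `r`; four configurations with the five localised displacement rows
(`δ·s` along `d`, `δ·t` along `d′`, mixed `μ·s·t` along `d + d′`); symmetric `dist`, 1-Lipschitz profiles, ball count `V`, `R ≤ d a + d′ a`,
`Σ_a e^{−θ₂ d a} ≤ S_loc` (`0 ≤ θ₂ ≤ θ`).  Then, with `W := V²·e^{2θr}·δ` and `E := e^{−(θ−θ₂)R}`, the nine summed rows of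
`abs_fourPt_trace_inv_mul_le_of_summedProfiles` hold with `k₁ = k₂ = L_K·W`, `h₁ = h₂ = L_H·W`, `k₁₂ = (L_K·V·μ + L_K₂·V²·δ²)·e^{2θr}·V·S_loc`,
`h₁₂ = (L_H·V·μ + L_H₂·V²·δ²)·e^{2θr}·V·S_loc`. [cite: Balaban1985Variational, Thm 1 (10) p. 279] -/
theorem summedRows_of_localMaps (dist : n → n → ℕ) (hds : ∀ a b, dist a b = dist b a)
    {K H : (n → ℝ) → Matrix n n ℝ} {LK LK₂ LH LH₂ : ℝ} {r : ℕ}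
    (hLK : 0 ≤ LK) (hLK₂ : 0 ≤ LK₂) (hLH : 0 ≤ LH) (hLH₂ : 0 ≤ LH₂)
    (hKloc : ∀ U U' i j, |K U i j - K U' i j| ≤ LK * ∑ k ∈ univ.filter (fun k => dist i k ≤ r), |U k - U' k|)
    (hKloc₂ : ∀ U a b i j, |K (U + a + b) i j - K (U + a) i j - K (U + b) i j + K U i j| ≤
      LK₂ * (∑ k ∈ univ.filter (fun k => dist i k ≤ r), |a k|) * (∑ k ∈ univ.filter (fun k => dist i k ≤ r), |b k|))
    (hHloc : ∀ U U' i j, |H U i j - H U' i j| ≤ LH * ∑ k ∈ univ.filter (fun k => dist i k ≤ r), |U k - U' k|)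
    (hHloc₂ : ∀ U a b i j, |H (U + a + b) i j - H (U + a) i j - H (U + b) i j + H U i j| ≤
      LH₂ * (∑ k ∈ univ.filter (fun k => dist i k ≤ r), |a k|) * (∑ k ∈ univ.filter (fun k => dist i k ≤ r), |b k|))
    (hKr : ∀ U a b, K U a b ≠ 0 → dist a b ≤ r) (hHr : ∀ U a b, H U a b ≠ 0 → dist a b ≤ r)
    {V : ℕ} (hV : ∀ a, (univ.filter fun b => dist a b ≤ r).card ≤ V)
    {θ θ₂ : ℝ} (hθ₂ : 0 ≤ θ₂) (hθ₂θ : θ₂ ≤ θ)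
    {d d' : n → ℕ} (hd : ∀ i k, d i ≤ dist i k + d k) (hd' : ∀ i k, d' i ≤ dist i k + d' k)
    {R : ℕ} (hsep₂ : ∀ a, R ≤ d a + d' a)
    {Sloc : ℝ} (hSd : ∑ a, Real.exp (-(θ₂ * d a)) ≤ Sloc)
    {U₀₀ U₁₀ U₀₁ U₁₁ : n → ℝ} {δ μ s t : ℝ} (hδ : 0 ≤ δ) (hμ : 0 ≤ μ) (hs : 0 ≤ s) (ht : 0 ≤ t)
    (hD10 : ∀ k, |U₁₀ k - U₀₀ k| ≤ δ * s * Real.exp (-(θ * d k)))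
    (hD11 : ∀ k, |U₁₁ k - U₀₁ k| ≤ δ * s * Real.exp (-(θ * d k)))
    (hD01 : ∀ k, |U₀₁ k - U₀₀ k| ≤ δ * t * Real.exp (-(θ * d' k)))
    (hD11' : ∀ k, |U₁₁ k - U₁₀ k| ≤ δ * t * Real.exp (-(θ * d' k)))
    (hDD : ∀ k, |U₁₁ k - U₁₀ k - U₀₁ k + U₀₀ k| ≤ μ * s * t * Real.exp (-(θ * (d k + d' k)))) :
    (∀ b, ∑ a, |(K U₁₀ - K U₀₀) a b| ≤ (LK * (V ^ 2 * Real.exp (2 * θ * r) * δ)) * s * Real.exp (-(θ * d b))) ∧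
    (∀ b, ∑ a, |(K U₁₁ - K U₀₁) a b| ≤ (LK * (V ^ 2 * Real.exp (2 * θ * r) * δ)) * s * Real.exp (-(θ * d b))) ∧
    (∀ a, ∑ b, |(K U₁₀ - K U₀₀) a b| ≤ (LK * (V ^ 2 * Real.exp (2 * θ * r) * δ)) * s * Real.exp (-(θ * d a))) ∧
    (∀ b, ∑ a, |(K U₁₁ - K U₁₀) a b| ≤ (LK * (V ^ 2 * Real.exp (2 * θ * r) * δ)) * t * Real.exp (-(θ * d' b))) ∧
    (∀ a, ∑ b, |(K U₀₁ - K U₀₀) a b| ≤ (LK * (V ^ 2 * Real.exp (2 * θ * r) * δ)) * t * Real.exp (-(θ * d' a))) ∧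
    (∑ a, ∑ b, |(K U₁₁ - K U₁₀ - K U₀₁ + K U₀₀) a b| ≤
      ((LK * V * μ + LK₂ * V ^ 2 * δ ^ 2) * Real.exp (2 * θ * r) * V * Sloc) * s * t * Real.exp (-((θ - θ₂) * R))) ∧
    (∀ a, ∑ b, |(H U₁₀ - H U₀₀) a b| ≤ (LH * (V ^ 2 * Real.exp (2 * θ * r) * δ)) * s * Real.exp (-(θ * d a))) ∧
    (∀ a, ∑ b, |(H U₀₁ - H U₀₀) a b| ≤ (LH * (V ^ 2 * Real.exp (2 * θ * r) * δ)) * t * Real.exp (-(θ * d' a))) ∧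
    (∑ a, ∑ b, |(H U₁₁ - H U₁₀ - H U₀₁ + H U₀₀) a b| ≤
      ((LH * V * μ + LH₂ * V ^ 2 * δ ^ 2) * Real.exp (2 * θ * r) * V * Sloc) * s * t * Real.exp (-((θ - θ₂) * R))) := by
  have hθ : 0 ≤ θ := hθ₂.trans hθ₂θ
  have hV0 : (0 : ℝ) ≤ V := Nat.cast_nonneg _
  have hVr : ∀ a, ((univ.filter fun b => dist a b ≤ r).card : ℝ) ≤ V := fun a => by exact_mod_cast hV a
  have hVc : ∀ b, (univ.filter fun a => dist a b ≤ r).card ≤ V := by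
    intro b
    have : (univ.filter fun a => dist a b ≤ r) = (univ.filter fun a => dist b a ≤ r) :=
      Finset.filter_congr fun a _ => by rw [hds a b]
    rw [this]; exact hV b
  have hSloc0 : 0 ≤ Sloc := (Finset.sum_nonneg fun a _ => (Real.exp_pos _).le).trans hSd
  have her : Real.exp (θ * r) ≤ Real.exp (2 * θ * r) := Real.exp_le_exp.2 (by nlinarith [Nat.cast_nonneg (α := ℝ) r])
  -- profiles are 1-Lipschitz in the form §1 wants (`p b ≤ dist a b + p a`)
  have hdp : ∀ a b, d b ≤ dist a b + d a := by intro a b; have := hd b a; rw [hds] at this; omega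
  have hdp' : ∀ a b, d' b ≤ dist a b + d' a := by intro a b; have := hd' b a; rw [hds] at this; omega
  -- ranges of the differences
  have hKdr : ∀ U U' a b, (K U - K U') a b ≠ 0 → dist a b ≤ r := by
    intro U U' a b h
    rw [Matrix.sub_apply] at h
    by_cases h1 : K U a b = 0
    · exact hKr U' a b (by intro h2; exact h (by rw [h1, h2, sub_zero]))
    · exact hKr U a b h1
  have hHdr : ∀ U U' a b, (H U - H U') a b ≠ 0 → dist a b ≤ r := by
    intro U U' a b h
    rw [Matrix.sub_apply] at h
    by_cases h1 : H U a b = 0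
    · exact hHr U' a b (by intro h2; exact h (by rw [h1, h2, sub_zero]))
    · exact hHr U a b h1
  have hKddr : ∀ a b, (K U₁₁ - K U₁₀ - K U₀₁ + K U₀₀) a b ≠ 0 → dist a b ≤ r := by
    intro a b h
    simp only [Matrix.add_apply, Matrix.sub_apply] at h
    by_cases h1 : K U₁₁ a b = 0
    · by_cases h2 : K U₁₀ a b = 0
      · by_cases h3 : K U₀₁ a b = 0
        · exact hKr U₀₀ a b (by intro h4; exact h (by rw [h1, h2, h3, h4]; ring))
        · exact hKr U₀₁ a b h3
      · exact hKr U₁₀ a b h2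
    · exact hKr U₁₁ a b h1
  have hHddr : ∀ a b, (H U₁₁ - H U₁₀ - H U₀₁ + H U₀₀) a b ≠ 0 → dist a b ≤ r := by
    intro a b h
    simp only [Matrix.add_apply, Matrix.sub_apply] at h
    by_cases h1 : H U₁₁ a b = 0
    · by_cases h2 : H U₁₀ a b = 0
      · by_cases h3 : H U₀₁ a b = 0
        · exact hHr U₀₀ a b (by intro h4; exact h (by rw [h1, h2, h3, h4]; ring))
        · exact hHr U₀₁ a b h3
      · exact hHr U₁₀ a b h2
    · exact hHr U₁₁ a b h1
  -- POINTWISE one-profile rows of the first differences (locality × localised displacement)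
  have pK10 : ∀ i j, |(K U₁₀ - K U₀₀) i j| ≤ (LK * V * (δ * s) * Real.exp (θ * r)) * Real.exp (-(θ * d i)) := fun i j => by
    rw [Matrix.sub_apply]; exact abs_sub_le_of_local_of_expLocalised dist hLK hKloc hθ hd hVr (by positivity) hD10 i j
  have pK11 : ∀ i j, |(K U₁₁ - K U₀₁) i j| ≤ (LK * V * (δ * s) * Real.exp (θ * r)) * Real.exp (-(θ * d i)) := fun i j => by
    rw [Matrix.sub_apply]; exact abs_sub_le_of_local_of_expLocalised dist hLK hKloc hθ hd hVr (by positivity) hD11 i j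
  have pK01 : ∀ i j, |(K U₀₁ - K U₀₀) i j| ≤ (LK * V * (δ * t) * Real.exp (θ * r)) * Real.exp (-(θ * d' i)) := fun i j => by
    rw [Matrix.sub_apply]; exact abs_sub_le_of_local_of_expLocalised dist hLK hKloc hθ hd' hVr (by positivity) hD01 i j
  have pK11' : ∀ i j, |(K U₁₁ - K U₁₀) i j| ≤ (LK * V * (δ * t) * Real.exp (θ * r)) * Real.exp (-(θ * d' i)) := fun i j => by
    rw [Matrix.sub_apply]; exact abs_sub_le_of_local_of_expLocalised dist hLK hKloc hθ hd' hVr (by positivity) hD11' i j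
  have pH10 : ∀ i j, |(H U₁₀ - H U₀₀) i j| ≤ (LH * V * (δ * s) * Real.exp (θ * r)) * Real.exp (-(θ * d i)) := fun i j => by
    rw [Matrix.sub_apply]; exact abs_sub_le_of_local_of_expLocalised dist hLH hHloc hθ hd hVr (by positivity) hD10 i j
  have pH01 : ∀ i j, |(H U₀₁ - H U₀₀) i j| ≤ (LH * V * (δ * t) * Real.exp (θ * r)) * Real.exp (-(θ * d' i)) := fun i j => by
    rw [Matrix.sub_apply]; exact abs_sub_le_of_local_of_expLocalised dist hLH hHloc hθ hd' hVr (by positivity) hD01 i j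
  -- POINTWISE two-profile rows of the double differences
  have eU : U₀₀ + (U₁₀ - U₀₀) + (U₀₁ - U₀₀) + (U₁₁ - U₁₀ - U₀₁ + U₀₀) = U₁₁ ∧ U₀₀ + (U₁₀ - U₀₀) + (U₀₁ - U₀₀) = U₀₀ + (U₁₀ - U₀₀) + (U₀₁ - U₀₀)
      ∧ U₀₀ + (U₁₀ - U₀₀) = U₁₀ ∧ U₀₀ + (U₀₁ - U₀₀) = U₀₁ := by
    refine ⟨?_, rfl, ?_, ?_⟩ <;> (funext k; simp only [Pi.add_apply, Pi.sub_apply]; ring)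
  have pKK : ∀ i j, |(K U₁₁ - K U₁₀ - K U₀₁ + K U₀₀) i j| ≤
      ((LK * V * (μ * s * t) + LK₂ * V ^ 2 * (δ * s) * (δ * t)) * Real.exp (2 * θ * r)) * Real.exp (-(θ * (d i + d' i))) := by
    intro i j
    have h := abs_doubleDiff_le_of_local₂ dist hLK hLK₂ hKloc hKloc₂ hθ hd hd' hVr (U := U₀₀) (a := U₁₀ - U₀₀)
      (b := U₀₁ - U₀₀) (c := U₁₁ - U₁₀ - U₀₁ + U₀₀) (δ₁ := δ * s) (δ₂ := δ * t) (μ := μ * s * t) (by positivity) (by positivity)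
      (by positivity)
      (fun k => by simpa only [Pi.sub_apply] using hD10 k) (fun k => by simpa only [Pi.sub_apply] using hD01 k)
      (fun k => by simpa only [Pi.add_apply, Pi.sub_apply] using hDD k) i j
    rw [eU.1, eU.2.2.1, eU.2.2.2] at h
    simpa only [Matrix.add_apply, Matrix.sub_apply] using h
  have pHH : ∀ i j, |(H U₁₁ - H U₁₀ - H U₀₁ + H U₀₀) i j| ≤
      ((LH * V * (μ * s * t) + LH₂ * V ^ 2 * (δ * s) * (δ * t)) * Real.exp (2 * θ * r)) * Real.exp (-(θ * (d i + d' i))) := by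
    intro i j
    have h := abs_doubleDiff_le_of_local₂ dist hLH hLH₂ hHloc hHloc₂ hθ hd hd' hVr (U := U₀₀) (a := U₁₀ - U₀₀)
      (b := U₀₁ - U₀₀) (c := U₁₁ - U₁₀ - U₀₁ + U₀₀) (δ₁ := δ * s) (δ₂ := δ * t) (μ := μ * s * t) (by positivity) (by positivity)
      (by positivity)
      (fun k => by simpa only [Pi.sub_apply] using hD10 k) (fun k => by simpa only [Pi.sub_apply] using hD01 k)
      (fun k => by simpa only [Pi.add_apply, Pi.sub_apply] using hDD k) i j
    rw [eU.1, eU.2.2.1, eU.2.2.2] at h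
    simpa only [Matrix.add_apply, Matrix.sub_apply] using h
  -- SUMMED rows (range `r`, ball count `V`)
  -- helper: a row-profile pointwise bound with constant `c·e^{θr}` gives row sums `≤ c·V·e^{θr}` and column sums `≤ c·V·e^{2θr}`;
  -- both are `≤ (c·V·e^{2θr})`-rows.
  have rowK : ∀ {E : Matrix n n ℝ} {L' q : ℝ} {p : n → ℕ}, 0 ≤ L' → 0 ≤ q →
      (∀ i j, |E i j| ≤ (L' * V * q * Real.exp (θ * r)) * Real.exp (-(θ * p i))) → (∀ a b, E a b ≠ 0 → dist a b ≤ r) →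
      ∀ a, ∑ b, |E a b| ≤ (L' * (V : ℝ) ^ 2 * Real.exp (2 * θ * r) * q) * Real.exp (-(θ * p a)) := by
    intro E L' q p hL' hq hE hEr a
    have h := rowSum_le_of_profile_range dist (by positivity) hE hEr hV a
    refine h.trans ?_
    have h0 : 0 ≤ Real.exp (-(θ * p a)) := (Real.exp_pos _).le
    have : L' * ↑V * q * Real.exp (θ * ↑r) * ↑V ≤ L' * ↑V ^ 2 * Real.exp (2 * θ * ↑r) * q := by
      have := mul_le_mul_of_nonneg_left her (by positivity : 0 ≤ L' * (V:ℝ) ^ 2 * q)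
      nlinarith
    exact mul_le_mul_of_nonneg_right this h0
  have colK : ∀ {E : Matrix n n ℝ} {L' q : ℝ} {p : n → ℕ}, 0 ≤ L' → 0 ≤ q → (∀ a b, p b ≤ dist a b + p a) →
      (∀ i j, |E i j| ≤ (L' * V * q * Real.exp (θ * r)) * Real.exp (-(θ * p i))) → (∀ a b, E a b ≠ 0 → dist a b ≤ r) →
      ∀ b, ∑ a, |E a b| ≤ (L' * (V : ℝ) ^ 2 * Real.exp (2 * θ * r) * q) * Real.exp (-(θ * p b)) := by
    intro E L' q p hL' hq hp hE hEr b
    have h := colSum_le_of_profile_range dist (by positivity) hθ hp hE hEr hVc b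
    refine h.trans (le_of_eq ?_)
    have : Real.exp (θ * r) * Real.exp (θ * r) = Real.exp (2 * θ * r) := by rw [← Real.exp_add]; ring_nf
    rw [← this]; ring
  have hK1c0 := colK hLK (mul_nonneg hδ hs) hdp pK10 (hKdr U₁₀ U₀₀)
  have hK1c1 := colK hLK (mul_nonneg hδ hs) hdp pK11 (hKdr U₁₁ U₀₁)
  have hK1r0 := rowK hLK (mul_nonneg hδ hs) pK10 (hKdr U₁₀ U₀₀)
  have hK2c1 := colK hLK (mul_nonneg hδ ht) hdp' pK11' (hKdr U₁₁ U₁₀)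
  have hK2r0 := rowK hLK (mul_nonneg hδ ht) pK01 (hKdr U₀₁ U₀₀)
  have hH1r := rowK hLH (mul_nonneg hδ hs) pH10 (hHdr U₁₀ U₀₀)
  have hH2r := rowK hLH (mul_nonneg hδ ht) pH01 (hHdr U₀₁ U₀₀)
  -- ℓ¹ two-profile rows
  have hK12 := sum_sum_abs_le_of_twoProfile_range dist (η₀ := (LK * V * (μ * s * t) + LK₂ * V ^ 2 * (δ * s) * (δ * t)) *
      Real.exp (2 * θ * r)) (by positivity) hθ₂ hθ₂θ pKK hKddr hV hsep₂ hSd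
  have hH12 := sum_sum_abs_le_of_twoProfile_range dist (η₀ := (LH * V * (μ * s * t) + LH₂ * V ^ 2 * (δ * s) * (δ * t)) *
      Real.exp (2 * θ * r)) (by positivity) hθ₂ hθ₂θ pHH hHddr hV hsep₂ hSd
  refine ⟨fun b => ?_, fun b => ?_, fun a => ?_, fun b => ?_, fun a => ?_, ?_, fun a => ?_, fun a => ?_, ?_⟩
  · exact (hK1c0 b).trans (le_of_eq (by ring))
  · exact (hK1c1 b).trans (le_of_eq (by ring))
  · exact (hK1r0 a).trans (le_of_eq (by ring))
  · exact (hK2c1 b).trans (le_of_eq (by ring))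
  · exact (hK2r0 a).trans (le_of_eq (by ring))
  · exact hK12.trans (le_of_eq (by ring))
  · exact (hH1r a).trans (le_of_eq (by ring))
  · exact (hH2r a).trans (le_of_eq (by ring))
  · exact hH12.trans (le_of_eq (by ring))

/-! ## §2 The capstone: trace, ℓ¹ and Hilbert–Schmidt from a responding background, local maps and stiffness -/

/-- ★★★ **THE ONE-LOOP SECOND VARIATION FROM RESPONSE, LOCALITY AND STIFFNESS — trace, entrywise ℓ¹ and Hilbert–Schmidt, END TO END.**
DATA: a symmetric `ℕ`-pseudo-metric `dist` (`dist i i = 0`, triangle inequality); two maps `K, H : (n → ℝ) → Matrix n n ℝ` local of radius `1` with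
first∕second-order constants `L_K, L_K₂, L_H, L_H₂` and values of range `1`; ball count `V`; 1-Lipschitz profiles `d, d′` with `R ≤ d a + dist a b + d′ b`,
`R ≤ d a + d′ a`; local sums `S_loc, S_dist` (`0 ≤ θ₂ ≤ θ`); a two-parameter family of configurations `U(σ,τ)` on `[0,s]×[0,t]` with partial derivatives
`Uσ, Uτ` and mixed `Uστ = ∂_σUτ`, LOCALISED: `|Uσ| ≤ δ·e^{−θd}`, `|Uτ| ≤ δ·e^{−θd′}`, `|Uστ| ≤ μ·e^{−θ(d+d′)}` (the responding background along the two coarse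
moves); at the four corners `X ∈ {U(0,0), U(s,0), U(0,t), U(s,t)}` the Hessian `K X` has off-diagonal absolute row∕column sums `≤ h` and gap `m`
(`m·Σv² ≤ Σ v·(K X v)`), `h·(e^θ − 1) ≤ m∕2` (STIFFNESS); `Σ|H(U(0,0))| ≤ η`.  CONCLUSION, with `X := K(U(s,t))⁻¹H(U(s,t)) − K(U(s,0))⁻¹H(U(s,0)) −
K(U(0,t))⁻¹H(U(0,t)) + K(U(0,0))⁻¹H(U(0,0))` and `C` the constant of ✓`abs_fourPt_trace_inv_mul_le_of_floor`:
`|tr X| ≤ C·s·t·e^{−(θ−θ₂)R}`, `Σ_{a,e}|X a e| ≤ S_dist·C·s·t·e^{−(θ−θ₂)R}`, `√(Σ_{a,e}(X a e)²) ≤ S_dist·C·s·t·e^{−(θ−θ₂)R}`.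
PROOF: ✓`displacement_rows_of_deriv` ⟹ displacement rows; ✓`abs_fourPt_trace_inv_mul_le_of_floor` (trace); ✓`coercive_combes_thomas_real` ∘
✓`sq_floor_of_quadratic_floor` (Combes–Thomas rows), `summedRows_of_localMaps`, ✓`sum_sum_abs_fourPt_inv_mul_le_of_summedProfiles` ∕
✓`sqrt_sum_sum_sq_fourPt_inv_mul_le_of_summedProfiles` (ℓ¹, HS). [cite: Balaban1985Variational, Thm 1 (9)–(10) p. 279] [cite: AizenmanWarzel2015, §10.3] -/
theorem trace_l1_hs_fourPt_inv_mul_le_of_response (dist : n → n → ℕ) (hd0 : ∀ i, dist i i = 0) (hds : ∀ a b, dist a b = dist b a)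
    (hdt : ∀ i j k, dist i k ≤ dist i j + dist j k)
    {K H : (n → ℝ) → Matrix n n ℝ} {LK LK₂ LH LH₂ : ℝ}
    (hLK : 0 ≤ LK) (hLK₂ : 0 ≤ LK₂) (hLH : 0 ≤ LH) (hLH₂ : 0 ≤ LH₂)
    (hKloc : ∀ U U' i j, |K U i j - K U' i j| ≤ LK * ∑ k ∈ univ.filter (fun k => dist i k ≤ 1), |U k - U' k|)
    (hKloc₂ : ∀ U a b i j, |K (U + a + b) i j - K (U + a) i j - K (U + b) i j + K U i j| ≤
      LK₂ * (∑ k ∈ univ.filter (fun k => dist i k ≤ 1), |a k|) * (∑ k ∈ univ.filter (fun k => dist i k ≤ 1), |b k|))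
    (hHloc : ∀ U U' i j, |H U i j - H U' i j| ≤ LH * ∑ k ∈ univ.filter (fun k => dist i k ≤ 1), |U k - U' k|)
    (hHloc₂ : ∀ U a b i j, |H (U + a + b) i j - H (U + a) i j - H (U + b) i j + H U i j| ≤
      LH₂ * (∑ k ∈ univ.filter (fun k => dist i k ≤ 1), |a k|) * (∑ k ∈ univ.filter (fun k => dist i k ≤ 1), |b k|))
    (hKr : ∀ U a b, K U a b ≠ 0 → dist a b ≤ 1) (hHr : ∀ U a b, H U a b ≠ 0 → dist a b ≤ 1)
    {V : ℕ} (hV : ∀ a, (univ.filter fun b => dist a b ≤ 1).card ≤ V)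
    {θ θ₂ : ℝ} (hθ₂ : 0 ≤ θ₂) (hθ₂θ : θ₂ ≤ θ)
    {d d' : n → ℕ} (hd : ∀ i k, d i ≤ dist i k + d k) (hd' : ∀ i k, d' i ≤ dist i k + d' k)
    {R : ℕ} (hsep : ∀ a b, R ≤ d a + dist a b + d' b) (hsep₂ : ∀ a, R ≤ d a + d' a)
    {Sloc Sdist : ℝ} (hSd : ∑ a, Real.exp (-(θ₂ * d a)) ≤ Sloc) (hSd' : ∑ a, Real.exp (-(θ₂ * d' a)) ≤ Sloc)
    (hSdi : ∀ a, ∑ b, Real.exp (-(θ₂ * dist a b)) ≤ Sdist) (hSdist0 : 0 ≤ Sdist)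
    {U Uσ Uτ Uστ : ℝ → ℝ → n → ℝ} {δ μ s t : ℝ} (hδ : 0 ≤ δ) (hμ : 0 ≤ μ) (hs : 0 ≤ s) (ht : 0 ≤ t)
    (hUσ : ∀ σ ∈ Icc (0 : ℝ) s, ∀ τ ∈ Icc (0 : ℝ) t, ∀ k, HasDerivAt (fun σ => U σ τ k) (Uσ σ τ k) σ)
    (hUτ : ∀ σ ∈ Icc (0 : ℝ) s, ∀ τ ∈ Icc (0 : ℝ) t, ∀ k, HasDerivAt (fun τ => U σ τ k) (Uτ σ τ k) τ)
    (hUστ : ∀ σ ∈ Icc (0 : ℝ) s, ∀ τ ∈ Icc (0 : ℝ) t, ∀ k, HasDerivAt (fun σ => Uτ σ τ k) (Uστ σ τ k) σ)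
    (bσ : ∀ σ ∈ Icc (0 : ℝ) s, ∀ τ ∈ Icc (0 : ℝ) t, ∀ k, |Uσ σ τ k| ≤ δ * Real.exp (-(θ * d k)))
    (bτ : ∀ σ ∈ Icc (0 : ℝ) s, ∀ τ ∈ Icc (0 : ℝ) t, ∀ k, |Uτ σ τ k| ≤ δ * Real.exp (-(θ * d' k)))
    (bστ : ∀ σ ∈ Icc (0 : ℝ) s, ∀ τ ∈ Icc (0 : ℝ) t, ∀ k, |Uστ σ τ k| ≤ μ * Real.exp (-(θ * (d k + d' k))))
    {h m : ℝ} (hm : 0 < m)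
    (hrow : ∀ X : n → ℝ, (X = U 0 0 ∨ X = U s 0 ∨ X = U 0 t ∨ X = U s t) →
      ∀ i, ∑ j ∈ univ.filter (fun j => dist i j ≠ 0), |K X i j| ≤ h)
    (hcol : ∀ X : n → ℝ, (X = U 0 0 ∨ X = U s 0 ∨ X = U 0 t ∨ X = U s t) →
      ∀ j, ∑ i ∈ univ.filter (fun i => dist i j ≠ 0), |K X i j| ≤ h)
    (hfloor : ∀ X : n → ℝ, (X = U 0 0 ∨ X = U s 0 ∨ X = U 0 t ∨ X = U s t) →
      ∀ v : n → ℝ, m * ∑ i, (v i) ^ 2 ≤ ∑ i, v i * (K X *ᵥ v) i)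
    (hη' : h * (Real.exp θ - 1) ≤ m / 2)
    {η : ℝ} (hη : ∑ x, ∑ y, |H (U 0 0) x y| ≤ η) :
    |((K (U s t))⁻¹ * H (U s t)).trace - ((K (U s 0))⁻¹ * H (U s 0)).trace - ((K (U 0 t))⁻¹ * H (U 0 t)).trace
        + ((K (U 0 0))⁻¹ * H (U 0 0)).trace| ≤
      (((2 / m) * (LH * V * μ + LH₂ * V ^ 2 * δ ^ 2) + (2 / m) ^ 2 * η * (LK * V * μ + LK₂ * V ^ 2 * δ ^ 2)) *
            Real.exp (2 * θ) * V * Sloc +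
          2 * (2 / m) ^ 2 * Sloc * Sdist * LK * (LH + (2 / m) * η * LK) * (V ^ 2 * Real.exp (2 * θ) * δ) ^ 2) *
        s * t * Real.exp (-((θ - θ₂) * R)) ∧
    ∑ a, ∑ e, |((K (U s t))⁻¹ * H (U s t) - (K (U s 0))⁻¹ * H (U s 0) - (K (U 0 t))⁻¹ * H (U 0 t) + (K (U 0 0))⁻¹ * H (U 0 0)) a e| ≤
      Sdist * (((2 / m) * (LH * V * μ + LH₂ * V ^ 2 * δ ^ 2) + (2 / m) ^ 2 * η * (LK * V * μ + LK₂ * V ^ 2 * δ ^ 2)) *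
            Real.exp (2 * θ) * V * Sloc +
          2 * (2 / m) ^ 2 * Sloc * Sdist * LK * (LH + (2 / m) * η * LK) * (V ^ 2 * Real.exp (2 * θ) * δ) ^ 2) *
        s * t * Real.exp (-((θ - θ₂) * R)) ∧
    Real.sqrt (∑ a, ∑ e, (((K (U s t))⁻¹ * H (U s t) - (K (U s 0))⁻¹ * H (U s 0) - (K (U 0 t))⁻¹ * H (U 0 t) +
        (K (U 0 0))⁻¹ * H (U 0 0)) a e) ^ 2) ≤
      Sdist * (((2 / m) * (LH * V * μ + LH₂ * V ^ 2 * δ ^ 2) + (2 / m) ^ 2 * η * (LK * V * μ + LK₂ * V ^ 2 * δ ^ 2)) *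
            Real.exp (2 * θ) * V * Sloc +
          2 * (2 / m) ^ 2 * Sloc * Sdist * LK * (LH + (2 / m) * η * LK) * (V ^ 2 * Real.exp (2 * θ) * δ) ^ 2) *
        s * t * Real.exp (-((θ - θ₂) * R)) := by
  have hθ : 0 ≤ θ := hθ₂.trans hθ₂θ
  have hα : (0 : ℝ) ≤ 2 / m := by positivity
  -- the five displacement rows from the derivative rows
  obtain ⟨hD10, hD11, hD01, hD11', hDD⟩ := displacement_rows_of_deriv hs ht hUσ hUτ hUστ bσ bτ bστ
  -- the trace bound
  have htr := abs_fourPt_trace_inv_mul_le_of_floor dist hd0 hds hdt hLK hLK₂ hLH hLH₂ hKloc hKloc₂ hHloc hHloc₂ hKr hHr hV hθ₂ hθ₂θ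
    hd hd' hsep hsep₂ hSd hSd' hSdi hSdist0 hδ hμ hs ht hD10 hD11 hD01 hD11' hDD hm hrow hcol hfloor hη' hη
  refine ⟨htr, ?_⟩
  -- Combes–Thomas at each corner
  have ct : ∀ X : n → ℝ, (X = U 0 0 ∨ X = U s 0 ∨ X = U 0 t ∨ X = U s t) →
      (K X).det ≠ 0 ∧ ∀ a b, |(K X)⁻¹ a b| ≤ 2 / m * Real.exp (-(θ * dist a b)) := by
    intro X hX
    obtain ⟨hdet, hA⟩ := coercive_combes_thomas_real dist hd0 hds hdt (K X) (hKr X) h (hrow X hX) (hcol X hX) m θ hm hθ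
      (sq_floor_of_quadratic_floor (K X) hm (hfloor X hX)) hη'
    exact ⟨hdet.ne_zero, hA⟩
  obtain ⟨h₀₀, hA₀₀⟩ := ct (U 0 0) (Or.inl rfl)
  obtain ⟨h₁₀, hA₁₀⟩ := ct (U s 0) (Or.inr (Or.inl rfl))
  obtain ⟨h₀₁, hA₀₁⟩ := ct (U 0 t) (Or.inr (Or.inr (Or.inl rfl)))
  obtain ⟨h₁₁, hA₁₁⟩ := ct (U s t) (Or.inr (Or.inr (Or.inr rfl)))
  -- the nine summed rows
  obtain ⟨r1, r2, r3, r4, r5, r6, r7, r8, r9⟩ := summedRows_of_localMaps dist hds hLK hLK₂ hLH hLH₂ hKloc hKloc₂ hHloc hHloc₂ hKr hHr hV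
    hθ₂ hθ₂θ hd hd' hsep₂ hSd hδ hμ hs ht hD10 hD11 hD01 hD11' hDD
  have hW : (0 : ℝ) ≤ LK * (V ^ 2 * Real.exp (2 * θ * (1 : ℕ)) * δ) := by positivity
  have hW' : (0 : ℝ) ≤ LH * (V ^ 2 * Real.exp (2 * θ * (1 : ℕ)) * δ) := by positivity
  have hl1 := sum_sum_abs_fourPt_inv_mul_le_of_summedProfiles dist hds h₀₀ h₀₁ h₁₀ h₁₁ hα hW hW hW' hW' hs ht hθ₂ hθ₂θ hSdist0
    hA₀₀ hA₀₁ hA₁₀ hA₁₁ hsep hSd hSd' hSdi r1 r2 r3 r4 r5 r6 hη r7 r8 r9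
  have hhs := sqrt_sum_sum_sq_fourPt_inv_mul_le_of_summedProfiles dist hds h₀₀ h₀₁ h₁₀ h₁₁ hα hW hW hW' hW' hs ht hθ₂ hθ₂θ hSdist0
    hA₀₀ hA₀₁ hA₁₀ hA₁₁ hsep hSd hSd' hSdi r1 r2 r3 r4 r5 r6 hη r7 r8 r9
  simp only [Nat.cast_one, mul_one] at hl1 hhs
  exact ⟨hl1.trans (le_of_eq (by ring)), hhs.trans (le_of_eq (by ring))⟩

end Literature.Analysis.Matrix

end
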